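import Summits.CriticalPhenomena.PercolationContinuityZ3.Theorems.PercNearOneGluingNoHeavyConstsCrossEdgeMarkerAll
import Summits.CriticalPhenomena.PercolationContinuityZ3.Theorems.PercNearOneGluingNoHeavyConstsCrossReachOnReach
import HarnessLib

/-!
# CROSS at the marker `u = z` for every monotone functional whose upper level sets are comparable with `{s↔y}` or with `{s↔z}` (assembly; gen 21)

builds on p205010 (kernel theorem, internal audit signed; external expert review pending).  Support file (`--supports
stmt-CriticalPhenomena-4575`); one theorem, no sorries, standard axioms.  Memo `run/shared/lean/prim/consts/FROM-prim-consts-2-g21-GIBBS-ORBIT.md` §3c.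

* `Consts.crossRel_marker_of_levelSets_YZ` — **THEOREM: for every weighted graph, all `s, y, z, X` and every MONOTONE `F : Set (Sym2 V) → ℝ` such that for every value
  `t > F(∅)` of `F` the upper level set `{t ≤ F}` is (i) pinned below `{s↔y}` (`t ≤ F(C_s) ⟹ s↔y`), or (ii) saturated above it (`s↔y ⟹ t ≤ F(C_s)`), or (iii) pinned
  below `{z ∈ V(C)}` (`F(C) < t` for every edge set `C` with no pair containing `z`), or (iv) saturated above it (`t ≤ F(C)` whenever `z = s` or a pair of `C` contains `z`)
  — the four classes may be mixed across thresholds — both CROSS members of `Consts.CrossRel` at `X ⊂ X ∪ {z}` are `≥ 0`.**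
  Ingredients: the general layer cake `Consts.crossMembers_nonneg_of_levelSets` (`…CrossEdgeMarkerAll`), the marker classes (`Consts.crossRel_edge_of_markerComparable`),
  the reach classes (`Consts.crossRel_reach_of_eq_off_reach`, `…ConstsCrossReach`; `Consts.crossRel_reach_of_eq_on_reach'`, `…ConstsCrossReachOnReach`).
What remains of `Consts.CrossRel` at `u = z` after this file: monotone `F` with an upper level set comparable with NEITHER marker event (memo §5(viii-1):
the Strassen transport statement `Cov_{μ(·|s↮X)}(1_U, κ) ≥ 0`).
[cite: VandenbergHaggstromKahn2005, Thm. 1.1 (pp. 3–5), Thm. 1.3 (p. 6), §2.1 (pp. 9–13)]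
-/

noncomputable section

namespace Summit.CriticalPhenomena.PercolationContinuityZ3.Theorems

open MeasureTheory Set Literature.Probability.LatticeModels Literature.Probability.Percolation
open scoped Classical

namespace Consts

variable {V : Type} [DecidableEq V] [Fintype V] (w : Sym2 V → unitInterval)

/-- **CROSS at `u = z` for monotone functionals with marker-comparable upper level sets (four classes, mixed thresholds).**  See the module docstring.
[cite: VandenbergHaggstromKahn2005, Thm. 1.1 (pp. 3–5), §2.1 (pp. 9–13)] -/
theorem crossRel_marker_of_levelSets_YZ (s y z : V) (X : Set V) (F : Set (Sym2 V) → ℝ) (hFm : Monotone F)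
    (hlev : ∀ t : ℝ, F ∅ < t → (∃ C, F C = t) →
      (∀ ω : BondConfig V, t ≤ F (openEdgeCluster ω s) → (openGraph ω).Reachable s y) ∨
        (∀ ω : BondConfig V, (openGraph ω).Reachable s y → t ≤ F (openEdgeCluster ω s)) ∨
        (∀ C : Set (Sym2 V), (∀ e ∈ C, z ∉ e) → F C < t) ∨
        (∀ C : Set (Sym2 V), (z = s ∨ ∃ e ∈ C, z ∈ e) → t ≤ F C)) :
    (0 ≤ polMargin (prodBernoulli w) s y z F (insert z X) X X + polMargin (prodBernoulli w) s y z F X (insert z X) X +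
        polMargin (prodBernoulli w) s y z F X X (insert z X)) ∧
      0 ≤ polMargin (prodBernoulli w) s y z F (insert z X) (insert z X) X +
          polMargin (prodBernoulli w) s y z F (insert z X) X (insert z X) +
        polMargin (prodBernoulli w) s y z F X (insert z X) (insert z X) := by
  refine crossMembers_nonneg_of_levelSets w s y z z X
    (fun G => (∀ ω : BondConfig V, G (openEdgeCluster ω s) = 1 → (openGraph ω).Reachable s y) ∨
      (∀ ω : BondConfig V, (openGraph ω).Reachable s y → G (openEdgeCluster ω s) = 1) ∨
      (∀ C : Set (Sym2 V), (∀ e ∈ C, z ∉ e) → G C = G ∅) ∨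
      (∀ C : Set (Sym2 V), (z = s ∨ ∃ e ∈ C, z ∈ e) → G C = 1))
    (fun G hGm hG01 hP => ?_) F hFm ?_
  · rcases hP with h | h | h | h
    · exact crossRel_edge_of_markerComparable w s y z X G hGm hG01 (Or.inl h)
    · exact crossRel_edge_of_markerComparable w s y z X G hGm hG01 (Or.inr h)
    · exact crossRel_reach_of_eq_off_reach w s y z X G hGm h
    · exact crossRel_reach_of_eq_on_reach' w s y z X G hGm 1 h
  · intro t ht hex
    rcases hlev t ht hex with h | h | h | h
    · refine Or.inl fun ω hω => h ω ?_
      by_contra hn; simp only [if_neg hn] at hω; exact zero_ne_one hω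
    · exact Or.inr (Or.inl fun ω hω => by simp only [if_pos (h ω hω)])
    · refine Or.inr (Or.inr (Or.inl fun C hC => ?_))
      have h1 : ¬ t ≤ F C := not_le.mpr (h C hC)
      have h2 : ¬ t ≤ F ∅ := not_le.mpr ht
      simp only [if_neg h1, if_neg h2]
    · exact Or.inr (Or.inr (Or.inr fun C hC => by simp only [if_pos (h C hC)]))

end Consts

end Summit.CriticalPhenomena.PercolationContinuityZ3.Theorems

end
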